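import Summits.PneNP.PneNP.Theses.RamseyUncertifiable

/-!
# `RegularResolutionRung` (stmt-PneNP-9818), negative side I: the lines of a short REGULAR
# refutation of `Clique(∅ₙ, k)`

Support file of the crux disprover (cdisprove seat) for `RamseyUncertifiable.RegularResolutionRung`
(self-contained copy of part of the crux work file `Cruxes/RegularResolutionRung/Disproof.lean`).
Contents: `cliqueCNF n k adj` — the route's inlined unary clique CNF (`let cnf`) as a named
definition (the crux is definitionally its restatement, see `OneSidedFalse.lean`); two generic
tools — `isResDerivation_map_range` (validity of a derivation presented by an index function) and
`isRegular_of_strictRank` (regularity from a strictly decreasing rank); and the explicit line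
function `line n a` of a `2n² + n + 2`-line refutation of `Clique(∅ₙ, k)` using only blocks 0 and 1
(units `¬x_{1,s}` from `⋁_u x_{0,u}` and the edge axioms `¬x_{0,t} ∨ ¬x_{1,s}`, then empty
`⋁_v x_{1,v}`), with its region lemmas. Validity, regularity and the refutation of the one-sided
cruxes are in `OneSidedFalse.lean`. [folklore]
-/

namespace Summit.PneNP.PneNP.Theorems.RegularResolutionRung.Negative

open Literature.Computability.MetaComplexity Literature.Computability.Complexity

/-- The unary clique CNF `Clique(G,k)` exactly as inlined (`let cnf`) in the route file. -/
def cliqueCNF (n k : ℕ) (adj : Fin n → Fin n → Bool) : CNF ℕ :=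
  ((List.range k).map fun i => (List.finRange n).map fun v => (i * n + (v : ℕ), true)) ++ ((List.range k).flatMap fun i => (List.finRange n).flatMap fun u => (List.finRange n).flatMap fun v => if u < v then [[(i * n + (u : ℕ), false), (i * n + (v : ℕ), false)]] else []) ++ ((List.range k).flatMap fun i => (List.range k).flatMap fun j => (List.finRange n).flatMap fun u => (List.finRange n).flatMap fun v => if i ≠ j ∧ adj u v = false then [[(i * n + (u : ℕ), false), (j * n + (v : ℕ), false)]] else [])

/-- A derivation presented as `(List.range L).map f` is valid as soon as every line `f a` is an axiom, or is justified by lines of smaller index. -/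
theorem isResDerivation_map_range {φ : CNF ℕ} {f : ℕ → ResLine ℕ} {L : ℕ}
    (hinit : ∀ a < L, (f a).rule = .initial → (f a).clause ∈ φ.clauseFinsets)
    (hres : ∀ a < L, ∀ i j v, (f a).rule = .resolve i j v →
      i < a ∧ j < a ∧ IsResolvent (f i).clause (f j).clause v (f a).clause)
    (hweak : ∀ a < L, ∀ i, (f a).rule = .weaken i → i < a ∧ (f i).clause ⊆ (f a).clause) :
    IsResDerivation φ ((List.range L).map f) := by
  intro a ha
  have haL : a < L := by simpa using ha
  have hget : ((List.range L).map f)[a]'ha = f a := by simp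
  have htake : ((List.range L).map f).take a = (List.range a).map f := by
    rw [← List.map_take, List.take_range, Nat.min_eq_left haL.le]
  rw [hget, htake]
  unfold IsValidResLine
  split
  · next heq => exact hinit a haL heq
  · next i j v heq =>
    obtain ⟨hi, hj, hr⟩ := hres a haL i j v heq
    refine ⟨by simpa using hi, by simpa using hj, ?_⟩
    simpa using hr
  · next i heq =>
    obtain ⟨hi, hsub⟩ := hweak a haL i heq
    refine ⟨by simpa using hi, ?_⟩
    simpa using hsub

/-- Regularity from a strictly decreasing rank: if every premise has strictly smaller rank than its conclusion and resolution lines with equal pivots have equal rank, then no DAG path resolves a variable twice. -/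
theorem isRegular_of_strictRank {ν : Type*} (π : List (ResLine ν)) (rank : ℕ → ℕ)
    (hlt : ∀ a (ha : a < π.length), ∀ b ∈ (π[a]).premises, rank b < rank a)
    (hinj : ∀ a (ha : a < π.length) a' (ha' : a' < π.length) v,
      (π[a]).rule.pivot? = some v → (π[a']).rule.pivot? = some v → rank a = rank a') :
    IsRegular π := by
  intro p hp
  obtain ⟨hlen, hchain⟩ := hp
  have hlen' : ∀ i ∈ p, i < π.length := by simpa using hlen
  have hch : List.IsChain (fun a b => rank b < rank a) p := by
    refine List.IsChain.imp_of_mem_imp (fun a b ha _ hab => ?_) hchain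
    have haπ : a < π.length := hlen' a ha
    have : (π.map ResLine.premises).getD a [] = (π[a]).premises := by
      simp [List.getD_eq_getElem?_getD, haπ]
    rw [this] at hab
    exact hlt a haπ b hab
  let _inst : Trans (fun a b => rank b < rank a) (fun a b => rank b < rank a)
      (fun a b => rank b < rank a) := ⟨fun h₁ h₂ => lt_trans h₂ h₁⟩
  have hpw : List.Pairwise (fun a b => rank b < rank a) p := hch.pairwise
  unfold pivotsAlong
  refine List.Pairwise.filterMap _ (fun a a' hlt' v hv v' hv' => ?_)
    (List.Pairwise.imp_of_mem (fun {a b} ha hb h => (⟨ha, hb, h⟩ : a ∈ p ∧ b ∈ p ∧ rank b < rank a)) hpw)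
  obtain ⟨ha, ha', hr⟩ := hlt'
  have haπ := hlen' a ha
  have ha'π := hlen' a' ha'
  have hva : (π[a]).rule.pivot? = some v := by simpa [haπ] using hv
  have hva' : (π[a']).rule.pivot? = some v' := by simpa [ha'π] using hv'
  intro hvv
  subst hvv
  have := hinj a haπ a' ha'π v hva hva'
  omega

/-! ## The explicit short regular refutation of `Clique(∅ₙ, k)` -/

/-- Positive block-0 literals `x_{0,u}` for `lo ≤ u < n` (variable `u`). -/
def pos0 (lo n : ℕ) : Finset (Literal ℕ) := (Finset.Ico lo n).image fun u => (u, true)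
/-- Positive block-1 literals `x_{1,v}` for `lo ≤ v < n` (variable `n + v`). -/
def pos1 (lo n : ℕ) : Finset (Literal ℕ) := (Finset.Ico lo n).image fun v => (n + v, true)
/-- The edge axiom `¬x_{0,t} ∨ ¬x_{1,s}` of the empty graph. -/
def clE (n t s : ℕ) : Finset (Literal ℕ) := {(t, false), (n + s, false)}
/-- The intermediate clause `x_{0,t+1} ∨ … ∨ x_{0,n-1} ∨ ¬x_{1,s}`. -/
def clR (n s t : ℕ) : Finset (Literal ℕ) := pos0 (t + 1) n ∪ {(n + s, false)}

/-- Membership in `pos0`. -/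
theorem mem_pos0 {lo n : ℕ} {x : Literal ℕ} : x ∈ pos0 lo n ↔ lo ≤ x.1 ∧ x.1 < n ∧ x.2 = true := by
  obtain ⟨a, b⟩ := x
  simp only [pos0, Finset.mem_image, Finset.mem_Ico, Prod.mk.injEq]
  constructor
  · rintro ⟨u, ⟨h1, h2⟩, rfl, rfl⟩; exact ⟨h1, h2, rfl⟩
  · rintro ⟨h1, h2, rfl⟩; exact ⟨a, ⟨h1, h2⟩, rfl, rfl⟩

/-- Membership in `pos1`. -/
theorem mem_pos1 {lo n : ℕ} {x : Literal ℕ} : x ∈ pos1 lo n ↔ n + lo ≤ x.1 ∧ x.1 < n + n ∧ x.2 = true := by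
  obtain ⟨a, b⟩ := x
  simp only [pos1, Finset.mem_image, Finset.mem_Ico, Prod.mk.injEq]
  constructor
  · rintro ⟨u, ⟨h1, h2⟩, rfl, rfl⟩; exact ⟨by omega, by omega, rfl⟩
  · rintro ⟨h1, h2, rfl⟩; exact ⟨a - n, ⟨by omega, by omega⟩, by omega, rfl⟩

/-- Erasing the first literal of `pos0`. -/
theorem pos0_erase {lo n : ℕ} : (pos0 lo n).erase (lo, true) = pos0 (lo + 1) n := by
  ext ⟨a, b⟩
  simp only [Finset.mem_erase, mem_pos0, ne_eq, Prod.mk.injEq]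
  cases b <;> simp
  omega

/-- Erasing the first literal of `pos1`. -/
theorem pos1_erase {lo n : ℕ} : (pos1 lo n).erase (n + lo, true) = pos1 (lo + 1) n := by
  ext ⟨a, b⟩
  simp only [Finset.mem_erase, mem_pos1, ne_eq, Prod.mk.injEq]
  cases b <;> simp
  omega

/-- `pos0 n n` is empty. -/
theorem pos0_self (n : ℕ) : pos0 n n = ∅ := by simp [pos0]
/-- `pos1 n n` is empty. -/
theorem pos1_self (n : ℕ) : pos1 n n = ∅ := by simp [pos1]

/-- Erasing the pivot from `clR`-shaped clauses. -/
theorem clR_erase {n s lo : ℕ} :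
    (pos0 lo n ∪ {(n + s, false)}).erase (lo, true) = pos0 (lo + 1) n ∪ {(n + s, false)} := by
  rw [Finset.erase_union_distrib, pos0_erase, Finset.erase_eq_of_notMem]
  simp

/-- Erasing the pivot from an edge axiom leaves the unit `¬x_{1,s}`. -/
theorem clE_erase {n t s : ℕ} (ht : t < n) : (clE n t s).erase (t, false) = {(n + s, false)} := by
  unfold clE
  rw [Finset.erase_insert]
  simp only [Finset.mem_singleton, Prod.mk.injEq, and_true]
  omega

/-- The lines of the refutation of `Clique(∅ₙ,k)`, by index: `0`: `⋁_v x_{1,v}`; `1`: `⋁_u x_{0,u}`; `2 + (sn+t)`: edge axiom `¬x_{0,t} ∨ ¬x_{1,s}`; `2 + n² + (sn+t)`: `clR n s t`, resolvent on `x_{0,t}` of the previous line (line `1` if `t = 0`) with line `2 + (sn+t)`; `2 + 2n² + s`: `x_{1,s+1} ∨ … ∨ x_{1,n-1}`, resolvent on `x_{1,s}` of the previous line (line `0` if `s = 0`) with the unit `¬x_{1,s}` (line `2 + n² + (sn + n-1)`); the last line is `∅`. -/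
def line (n a : ℕ) : ResLine ℕ :=
  if a = 0 then ⟨pos1 0 n, .initial⟩
  else if a = 1 then ⟨pos0 0 n, .initial⟩
  else if a < 2 + n * n then ⟨clE n ((a - 2) % n) ((a - 2) / n), .initial⟩
  else if a < 2 + 2 * (n * n) then
    ⟨clR n ((a - (2 + n * n)) / n) ((a - (2 + n * n)) % n),
      .resolve (if (a - (2 + n * n)) % n = 0 then 1 else a - 1) (a - n * n) ((a - (2 + n * n)) % n)⟩
  else ⟨pos1 (a - (2 + 2 * (n * n)) + 1) n,
      .resolve (if a - (2 + 2 * (n * n)) = 0 then 0 else a - 1)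
        (2 + n * n + ((a - (2 + 2 * (n * n))) * n + (n - 1))) (n + (a - (2 + 2 * (n * n))))⟩

/-- The explicit refutation: `2 + 2n² + n` lines. -/
def refutation (n : ℕ) : List (ResLine ℕ) := (List.range (2 + 2 * (n * n) + n)).map (line n)

/-- Its length. -/
theorem length_refutation (n : ℕ) : (refutation n).length = 2 + 2 * (n * n) + n := by
  simp [refutation]

section lines
variable {n : ℕ}

/-- Line `0`. -/
theorem line_zero : line n 0 = ⟨pos1 0 n, .initial⟩ := by simp [line]
/-- Line `1`. -/
theorem line_one : line n 1 = ⟨pos0 0 n, .initial⟩ := by simp [line]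
/-- Lines of the edge-axiom region. -/
theorem line_E {a : ℕ} (h2 : 2 ≤ a) (h : a < 2 + n * n) :
    line n a = ⟨clE n ((a - 2) % n) ((a - 2) / n), .initial⟩ := by
  unfold line
  rw [if_neg (by omega), if_neg (by omega), if_pos h]
/-- Lines of the inner-chain region. -/
theorem line_R {a : ℕ} (h1 : 2 + n * n ≤ a) (h : a < 2 + 2 * (n * n)) :
    line n a = ⟨clR n ((a - (2 + n * n)) / n) ((a - (2 + n * n)) % n),
      .resolve (if (a - (2 + n * n)) % n = 0 then 1 else a - 1) (a - n * n) ((a - (2 + n * n)) % n)⟩ := by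
  unfold line
  rw [if_neg (by omega), if_neg (by omega), if_neg (by omega), if_pos h]
/-- Lines of the outer-chain region. -/
theorem line_T {a : ℕ} (h1 : 2 + 2 * (n * n) ≤ a) :
    line n a = ⟨pos1 (a - (2 + 2 * (n * n)) + 1) n,
      .resolve (if a - (2 + 2 * (n * n)) = 0 then 0 else a - 1)
        (2 + n * n + ((a - (2 + 2 * (n * n))) * n + (n - 1))) (n + (a - (2 + 2 * (n * n))))⟩ := by
  unfold line
  rw [if_neg (by omega), if_neg (by omega), if_neg (by omega), if_neg (by omega)]

/-- Base-`n` digits of `s n + t`. -/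
theorem digits_of {s t : ℕ} (ht : t < n) : (s * n + t) / n = s ∧ (s * n + t) % n = t := by
  have hn : 0 < n := by omega
  constructor
  · rw [Nat.add_comm, Nat.add_mul_div_right _ _ hn, Nat.div_eq_of_lt ht, Nat.zero_add]
  · rw [Nat.add_comm, Nat.add_mul_mod_self_right, Nat.mod_eq_of_lt ht]

/-- The inner-chain index of digits `s, t < n` lies in its region. -/
theorem idxR_lt {s t : ℕ} (hs : s < n) (ht : t < n) :
    2 + n * n + (s * n + t) < 2 + 2 * (n * n) := by
  have := Nat.mul_le_mul_right n hs
  rw [Nat.succ_mul] at this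
  omega

/-- Case analysis of an index `< 2 + 2n² + n` into the five regions. -/
theorem region_cases {a : ℕ} (hn : 1 ≤ n) (ha : a < 2 + 2 * (n * n) + n) :
    a = 0 ∨ a = 1 ∨ (∃ s t, s < n ∧ t < n ∧ a = 2 + (s * n + t)) ∨
      (∃ s t, s < n ∧ t < n ∧ a = 2 + n * n + (s * n + t)) ∨
      (∃ s, s < n ∧ a = 2 + 2 * (n * n) + s) := by
  have hpos : 0 < n := hn
  have split : ∀ b < n * n, ∃ s t, s < n ∧ t < n ∧ b = s * n + t := fun b hb =>
    ⟨b / n, b % n, Nat.div_lt_of_lt_mul hb, Nat.mod_lt _ hpos, by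
      have := Nat.div_add_mod b n; rw [Nat.mul_comm] at this; omega⟩
  rcases Nat.lt_or_ge a 2 with h | h
  · rcases (by omega : a = 0 ∨ a = 1) with rfl | rfl <;> simp
  rcases Nat.lt_or_ge a (2 + n * n) with h' | h'
  · obtain ⟨s, t, hs, ht, e⟩ := split (a - 2) (by omega)
    exact Or.inr (Or.inr (Or.inl ⟨s, t, hs, ht, by omega⟩))
  rcases Nat.lt_or_ge a (2 + 2 * (n * n)) with h'' | h''
  · obtain ⟨s, t, hs, ht, e⟩ := split (a - (2 + n * n)) (by omega)
    exact Or.inr (Or.inr (Or.inr (Or.inl ⟨s, t, hs, ht, by omega⟩)))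
  · exact Or.inr (Or.inr (Or.inr (Or.inr ⟨a - (2 + 2 * (n * n)), by omega, by omega⟩)))

/-- Edge-axiom line in digit form. -/
theorem lineE_spec {s t : ℕ} (hs : s < n) (ht : t < n) :
    line n (2 + (s * n + t)) = ⟨clE n t s, .initial⟩ := by
  have := idxR_lt hs ht
  rw [line_E (by omega) (by omega)]
  simp only [Nat.add_sub_cancel_left, (digits_of ht).1, (digits_of ht).2]

/-- Inner-chain line in digit form. -/
theorem lineR_spec {s t : ℕ} (hs : s < n) (ht : t < n) :
    line n (2 + n * n + (s * n + t)) =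
      ⟨clR n s t, .resolve (if t = 0 then 1 else 2 + n * n + (s * n + t) - 1) (2 + (s * n + t)) t⟩ := by
  have hlt := idxR_lt hs ht
  rw [line_R (by omega) (by omega)]
  have e4 : 2 + n * n + (s * n + t) - n * n = 2 + (s * n + t) := by omega
  simp only [Nat.add_sub_cancel_left, (digits_of ht).1, (digits_of ht).2, e4]

/-- Outer-chain line in digit form. -/
theorem lineT_spec (s : ℕ) :
    line n (2 + 2 * (n * n) + s) =
      ⟨pos1 (s + 1) n, .resolve (if s = 0 then 0 else 2 + 2 * (n * n) + s - 1)
        (2 + n * n + (s * n + (n - 1))) (n + s)⟩ := by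
  rw [line_T (by omega)]
  simp only [Nat.add_sub_cancel_left]

end lines


/-! ### Membership of the axioms used -/

end Summit.PneNP.PneNP.Theorems.RegularResolutionRung.Negative
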